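import Literature.NumberTheory.Rogawski1990.IsQuotientOfHaarRatio                -- ★ p847850: `IsQuotientOf.exists_eq_smul`, `stableOrbitalIntegralRel_smul`, `classOrbitalIntegral_smul_measure_eq_mul`
import Literature.NumberTheory.Rogawski1990.TamagawaSingularMembersFinTFCovol   -- ★ p844690: the letters' FRAME vocabulary (`localStableOrbitalIntegral`, `UnitaryGroup.cmDatum`, the singular guard)
import HarnessLib

/-!
# `K2E4OneClassHaarRatioTransport` — a stable orbital integral read on ONE class transports by the Haar ratio of the two centraliser measures there
# (Rogawski 1990 §1.7 p. 6 «compatible measures», §4.1 (4.1.1) p. 39, §4.3 (4.3.1) p. 43; Deitmar–Echterhoff 2014 Thm. 1.5.3)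

Track B ∕ K2-LIT, crux h413 = `stmt-HodgeConjecture-24833`, route of record `HCCMUnconditional`; prover seat `hodgecm-mathlib-K2E4-p14` (g0);
lane `--supports stmt-HodgeConjecture-24833` (count-neutral).  THEOREMS ONLY (no `def`, no `instance`, no notation, no named-fact hypothesis, no `sorry`).
Helper «H7» of REPORT #1 (K2E4-p14) for the finite phase pin `pinFin` of socket #14 `sig_K2E4ExplicitKappaSign`
(`Cruxes/H413/Lines/K2_E4_SingularTransferKappaSignSigsSingularProductFormula.lean` :116).

WHY.  Socket #14 quantifies over EVERY coherent singular system `(mGs₀, tGs₀)` ((Q-fin)₀ (COH-fin)₀ (LEV)₀), while the phase sockets #2 ∕ #8 pin the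
constants of (κ-loc) for the |ω|_v-Tamagawa partners.  Two Weil-quotient families of the same Haar measure `νG_v` differ CLASS BY CLASS by the Haar ratio of
their centraliser measures (★ `IsQuotientOf.exists_eq_smul`), and (COH-fin)₀ relates `tGs₀` only along `G′_v`-conjugation — so at a non-split `v` the two
sheets of the local stable class of `γ_{0,v}` carry independent ratios, and the class-uniform transport ★ `stableOrbitalIntegralRel_eq_mul_of_forall_eq_smul`
does not apply.  It does apply to a test function CHARGING ONE CLASS ONLY: if `f` vanishes on every other conjugacy class of the stable class of `γ`, then
`Φ^st_m(γ, f)` reads the single member `m c₀`, and ONE weight `m c₀ = κ • m₀ c₀` comes out.  With such an `f` (helper «H6», a smooth transfer pair supported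
near the closed orbit of `γ_{0,v}`), (κ-loc)[mGs₀, c] and (κ-loc)[m^ω, c^ω] give `c_v = κ_v⁻¹ · c^ω_v` with `κ_v > 0`, i.e. the phase of `c_v` is that of `c^ω_v`.

* §1 (abstract group `G`, all relations parameters): `orbitalIntegral_eq_zero_of_forall_conj` (a function vanishing on the conjugacy class of `γ` has orbital
  integral `0` against ANY measure), `classOrbitalIntegral_eq_zero_of_forall_conj`, **`stableOrbitalIntegralRel_eq_mul_of_eq_smul_of_forall_conj`** (ONE weight
  at ONE class `c₀` + vanishing of `f` on the other classes of `𝒪_st(γ)` ⇒ `Φ^st_m(γ, f) = κ.toReal · Φ^st_{m₀}(γ, f)`).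
* §2 (locally compact second countable Hausdorff `G`, two Weil-quotient families of the SAME Haar measure): **`exists_pos_stableOrbitalIntegralRel_eq_mul_of_isQuotientOf`**
  — at a guarded class `c₀`, `∃ κ > 0, t (out c₀) = κ • t₀ (out c₀) ∧ Φ^st_m(γ, f) = κ⁻¹ · Φ^st_{m₀}(γ, f)` for every `f` vanishing on the other classes of `𝒪_st(γ)`.
* §3 (the constants): **`phasePin_transport`** — if `Φ^st_m(f) = c · a`, `Φ^st_{m₀}(f) = c₀ · a`, `Φ^st_m(f) = ρ · Φ^st_{m₀}(f)` with `ρ > 0` and `a ≠ 0`, then every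
  phase pin `c₀ · δ = ± r` (`r > 0`) of `c₀` is a phase pin `c · δ = ± (ρ r)` of `c` (both signs, as the conjunction used by #8 ∕ `pinFin`).
* §4 (NONNEGATIVE test functions — no single-class support needed): `orbitalIntegral_ofReal`, `orbitalIntegral_nonneg`, the `finsum` algebra
  `exists_pos_finsum_mem_eq_mul`, and **`exists_pos_stableOrbitalIntegralRel_eq_mul_of_nonneg`** — two Weil-quotient families of the same Haar measure, a guard
  holding on the whole stable class of `γ`, a REAL NONNEGATIVE `f` with `Φ^st_{m₀}(γ, f) ≠ 0` ⇒ `Φ^st_m(γ, f) = ρ · Φ^st_{m₀}(γ, f)` with `ρ > 0` (the class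
  ratios may differ between the sheets; positivity of every class orbital integral of `f` is what survives).  So the finite phase pin of socket #14 needs only ONE
  nonnegative smooth `f` charging `γ_{0,v}` for the |ω|-partners (socket #6 with a nonnegative witness) and its transfer (★ `IsLocalDeltaTransferExists` in `hCTM`).
* §5 the CM dress at a finite place `v` on the `cmDatum` carrier (★ `localStableOrbitalIntegral` is the §1 relation for ★ `IsStablyConj`):
  **`exists_pos_localStableOrbitalIntegral_eq_mul`**, **`exists_pos_localStableOrbitalIntegral_eq_mul_of_nonneg`**.

HONEST LABEL: HC_CM is proved only modulo the 7 printed citations (2 remaining named inputs: hLiu418 = `stmt-HodgeConjecture-24832`, h413 =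
`stmt-HodgeConjecture-24833`) until rung 0 closes; this file is unconditional measure bookkeeping and proves no printed statement.

## References
* [Rogawski1990] J. D. Rogawski, *Automorphic Representations of Unitary Groups in Three Variables*, Ann. of Math. Stud. 123 (1990), §1.7 p. 6
  (compatible measures), §4.1 (4.1.1) p. 39 (`Φ^st`), §4.3 (4.3.1) p. 43, §8.2 Prop. 8.2.1 (a), (b) p. 118.
* [DeitmarEchterhoff2014] A. Deitmar, S. Echterhoff, *Principles of Harmonic Analysis*, 2nd ed. (2014), Thm. 1.5.3 (Weil's quotient measure and its scaling).
-/

set_option autoImplicit false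
-- the mandated namespace repeats the single-problem summit's segment (`HodgeConjecture.HodgeConjecture`)
set_option linter.dupNamespace false

noncomputable section

open MeasureTheory Measure NumberField IsDedekindDomain
open Literature.MeasureTheory.Group
open Literature.NumberTheory.Rogawski1990 Literature.NumberTheory.Automorphic
open scoped ENNReal NNReal

namespace Summit.HodgeConjecture.HodgeConjecture.Cruxes.H413.K2E4OneClassHaarRatioTransport

/-! ## §1 A stable orbital integral read on one class -/

section Abstract

variable {G : Type*} [Group G] [∀ γ : G, MeasurableSpace (G ⧸ Subgroup.centralizer ({γ} : Set G))]

/-- **A function vanishing on the conjugacy class of `γ` has orbital integral `0` at `γ` against ANY measure** (the orbital integrand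
★ `descConj γ Z(γ) _ f : y ↦ f(y γ y⁻¹)` is identically `0`). [cite: Rogawski1990, §4.1 (4.1.1) p. 39] -/
theorem orbitalIntegral_eq_zero_of_forall_conj (γ : G) (f : G → ℂ) (hf : ∀ g : G, f (g * γ * g⁻¹) = 0)
    (μ : Measure (G ⧸ Subgroup.centralizer ({γ} : Set G))) : orbitalIntegral γ f μ = 0 := by
  have h0 : descConj γ (Subgroup.centralizer ({γ} : Set G)) (fun _ hg => Subgroup.mem_centralizer_singleton_iff.1 hg) f = fun _ => (0 : ℂ) := by
    funext y
    induction y using QuotientGroup.induction_on with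
    | H x => exact hf x
  rw [orbitalIntegral_eq_integral_descConj, h0, integral_zero]

/-- Class form: if `f` vanishes on the conjugacy class `c` (at the conjugates of its representative `out c`), then `Φ([c], f; m) = 0` for EVERY family `m`.
[cite: Rogawski1990, §4.1 (4.1.1) p. 39] -/
theorem classOrbitalIntegral_eq_zero_of_forall_conj (m : OrbitalMeasureFamily G) (f : G → ℂ) (c : ConjClasses G)
    (hf : ∀ g : G, f (g * Quotient.out c * g⁻¹) = 0) : classOrbitalIntegral m f c = 0 := by
  rw [classOrbitalIntegral_eq]
  exact orbitalIntegral_eq_zero_of_forall_conj _ f hf _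

/-- **ONE WEIGHT AT ONE CLASS COMES OUT OF `Φ^st(γ, ·)` ON A FUNCTION CHARGING THAT CLASS ONLY**: if `m c₀ = κ • m₀ c₀` and `f` vanishes on every
conjugacy class `c ≠ c₀` of `𝒪_st(γ)` (at the conjugates of `out c`), then `Φ^st_m(γ, f) = κ.toReal · Φ^st_{m₀}(γ, f)` — nothing is asked of `m`, `m₀`
at the other classes (there both summands are `0` for any measure).  Compare ★ `stableOrbitalIntegralRel_eq_mul_of_forall_eq_smul` (weight on the whole
stable class). [cite: Rogawski1990, §4.1 (4.1.1) p. 39; §1.7 p. 6] -/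
theorem stableOrbitalIntegralRel_eq_mul_of_eq_smul_of_forall_conj (st : G → G → Prop) {m m₀ : OrbitalMeasureFamily G} {γ : G} {κ : ℝ≥0∞}
    (c₀ : ConjClasses G) (h₀ : m c₀ = κ • m₀ c₀) (f : G → ℂ)
    (hf : ∀ c : ConjClasses G, st γ (Quotient.out c) → c ≠ c₀ → ∀ g : G, f (g * Quotient.out c * g⁻¹) = 0) :
    stableOrbitalIntegralRel st m f γ = (κ.toReal : ℂ) * stableOrbitalIntegralRel st m₀ f γ := by
  rw [← stableOrbitalIntegralRel_smul st κ m₀ f γ, stableOrbitalIntegralRel_def, stableOrbitalIntegralRel_def]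
  refine finsum_mem_congr rfl fun c hc => ?_
  by_cases hcc : c = c₀
  · subst hcc
    rw [classOrbitalIntegral_eq, classOrbitalIntegral_eq, h₀, OrbitalMeasureFamily.smul_apply]
  · rw [classOrbitalIntegral_eq_zero_of_forall_conj m f c (hf c hc hcc),
      classOrbitalIntegral_eq_zero_of_forall_conj (κ • m₀) f c (hf c hc hcc)]

end Abstract

/-! ## §2 Two Weil-quotient families of the same Haar measure, read on one guarded class -/

section Ratio

variable {G : Type*} [Group G] [TopologicalSpace G] [IsTopologicalGroup G] [LocallyCompactSpace G]
  [SecondCountableTopology G] [T2Space G] [MeasurableSpace G] [BorelSpace G]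
  [∀ γ : G, MeasurableSpace (G ⧸ Subgroup.centralizer ({γ} : Set G))]
  [∀ γ : G, BorelSpace (G ⧸ Subgroup.centralizer ({γ} : Set G))]

/-- **ONE-CLASS HAAR-RATIO TRANSPORT.**  Let `m = dν ∕ dt` and `m₀ = dν ∕ dt₀` on the `P`-classes (★ `IsQuotientOf`, SAME Haar `ν`), `c₀` a `P`-class, and
`f` a function vanishing on every class `c ≠ c₀` of `𝒪_st(γ)`.  Then for the Haar ratio `κ > 0` of the two centraliser measures at `out c₀`
(`t (out c₀) = κ • t₀ (out c₀)`, ★ `IsQuotientOf.exists_eq_smul`): `Φ^st_m(γ, f) = κ⁻¹ · Φ^st_{m₀}(γ, f)` (Weil: `dν ∕ d(κ t₀) = κ⁻¹ · dν ∕ dt₀`).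
[cite: Rogawski1990, §1.7 p. 6; §4.3 (4.3.1) p. 43] [cite: DeitmarEchterhoff2014, Thm. 1.5.3] -/
theorem exists_pos_stableOrbitalIntegralRel_eq_mul_of_isQuotientOf (st : G → G → Prop) {P : G → Prop} {ν : Measure G} [ν.IsHaarMeasure]
    [ν.IsMulRightInvariant] {t t₀ : ∀ γ : G, Measure (Subgroup.centralizer ({γ} : Set G))} {m m₀ : OrbitalMeasureFamily G}
    (h : m.IsQuotientOf P ν t) (h₀ : m₀.IsQuotientOf P ν t₀) {γ : G} (c₀ : ConjClasses G) (hc₀ : P (Quotient.out c₀)) (f : G → ℂ)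
    (hf : ∀ c : ConjClasses G, st γ (Quotient.out c) → c ≠ c₀ → ∀ g : G, f (g * Quotient.out c * g⁻¹) = 0) :
    ∃ κ : ℝ≥0, 0 < κ ∧ t (Quotient.out c₀) = κ • t₀ (Quotient.out c₀) ∧
      stableOrbitalIntegralRel st m f γ = ((κ⁻¹ : ℝ≥0) : ℂ) * stableOrbitalIntegralRel st m₀ f γ := by
  obtain ⟨κ, hκ, hst, hm⟩ := h.exists_eq_smul h₀ c₀ hc₀
  refine ⟨κ, hκ, hst, ?_⟩
  rw [stableOrbitalIntegralRel_eq_mul_of_eq_smul_of_forall_conj st c₀ hm f hf, ENNReal.coe_toReal]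

end Ratio

/-! ## §3 The constants: a phase pin transports along a positive ratio -/

/-- **PHASE-PIN TRANSPORT.**  If a functional value reads `S = c · a` and `S₀ = c₀ · a` with `a ≠ 0` (one test pair charging `γ_H`), and `S = ρ · S₀` with
`ρ > 0` (one-class Haar-ratio transport), then `c = ρ · c₀`; hence a two-branch phase pin of `c₀` against `δ` — `X → c₀ · δ = −r`, `¬ X → c₀ · δ = r`,
`r > 0` (the shape of socket #8 `sig_K2E4KottwitzSignOfSheets`, `X` = anisotropy of `W₂(γ₀)_v`) — is the same phase pin of `c` with `ρ · r > 0`.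
[cite: Rogawski1990, §8.2 Prop. 8.2.1 (a) p. 118; §1.7 p. 6] -/
theorem phasePin_transport {S S₀ c c₀ a δ : ℂ} {ρ : ℝ} (hρ : 0 < ρ) (hS : S = c * a) (hS₀ : S₀ = c₀ * a) (hSS₀ : S = (ρ : ℂ) * S₀) (ha : a ≠ 0)
    (X : Prop) (hpin : ∃ r : ℝ, 0 < r ∧ (X → c₀ * δ = -(r : ℂ)) ∧ (¬ X → c₀ * δ = (r : ℂ))) :
    ∃ r : ℝ, 0 < r ∧ (X → c * δ = -(r : ℂ)) ∧ (¬ X → c * δ = (r : ℂ)) := by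
  obtain ⟨r, hr, hX, hnX⟩ := hpin
  have hc : c = (ρ : ℂ) * c₀ := by
    apply mul_right_cancel₀ ha
    rw [← hS, hSS₀, hS₀, mul_assoc]
  refine ⟨ρ * r, mul_pos hρ hr, fun hx => ?_, fun hx => ?_⟩
  · rw [hc, mul_assoc, hX hx]; push_cast; ring
  · rw [hc, mul_assoc, hnX hx]; push_cast; ring

/-- One-branch form (the shape of socket #2 `sig_K2E4ExplicitSplitConstantPhase`: `c₀ · δ = r`, `r > 0`). [cite: Rogawski1990, §8.2 Prop. 8.2.1 (a) p. 118; §1.7 p. 6] -/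
theorem phasePin_transport_pos {S S₀ c c₀ a δ : ℂ} {ρ : ℝ} (hρ : 0 < ρ) (hS : S = c * a) (hS₀ : S₀ = c₀ * a) (hSS₀ : S = (ρ : ℂ) * S₀) (ha : a ≠ 0)
    (hpin : ∃ r : ℝ, 0 < r ∧ c₀ * δ = (r : ℂ)) : ∃ r : ℝ, 0 < r ∧ c * δ = (r : ℂ) := by
  obtain ⟨r, hr, h⟩ := hpin
  obtain ⟨r', hr', -, h'⟩ := phasePin_transport hρ hS hS₀ hSS₀ ha False ⟨r, hr, fun h => h.elim, fun _ => h⟩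
  exact ⟨r', hr', h' not_false⟩

/-! ## §4 NONNEGATIVE test functions: positive transport across two Weil families WITHOUT single-class support -/

section Nonneg

variable {G : Type*} [Group G] [∀ γ : G, MeasurableSpace (G ⧸ Subgroup.centralizer ({γ} : Set G))]

/-- The orbital integral of a real function coerced to `ℂ` is the coercion of its real orbital integral (Mathlib `integral_ofReal` on the orbit quotient).
[cite: Rogawski1990, §4.1 (4.1.1) p. 39] -/
theorem orbitalIntegral_ofReal (γ : G) (g : G → ℝ) (μ : Measure (G ⧸ Subgroup.centralizer ({γ} : Set G))) :
    orbitalIntegral γ (fun x => (g x : ℂ)) μ = ((orbitalIntegral γ g μ : ℝ) : ℂ) := by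
  have h : descConj γ (Subgroup.centralizer ({γ} : Set G)) (fun _ hg => Subgroup.mem_centralizer_singleton_iff.1 hg) (fun x => (g x : ℂ)) =
      fun y => ((descConj γ (Subgroup.centralizer ({γ} : Set G)) (fun _ hg => Subgroup.mem_centralizer_singleton_iff.1 hg) g y : ℝ) : ℂ) := by
    funext y
    induction y using QuotientGroup.induction_on with
    | H x => rfl
  rw [orbitalIntegral_eq_integral_descConj, orbitalIntegral_eq_integral_descConj, h]
  exact integral_ofReal

/-- The orbital integral of a NONNEGATIVE real function is nonnegative, against any measure (Mathlib `integral_nonneg`; no integrability needed).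
[cite: Rogawski1990, §4.1 (4.1.1) p. 39] -/
theorem orbitalIntegral_nonneg (γ : G) {g : G → ℝ} (hg : ∀ x, 0 ≤ g x) (μ : Measure (G ⧸ Subgroup.centralizer ({γ} : Set G))) :
    0 ≤ orbitalIntegral γ g μ := by
  rw [orbitalIntegral_eq_integral_descConj]
  refine integral_nonneg fun y => ?_
  induction y using QuotientGroup.induction_on with
  | H x => exact hg _

/-- **POSITIVE RATIO OF TWO CLASS SUMS WITH POSITIVE CLASS-BY-CLASS WEIGHTS** (pure `finsum` algebra): on a set `S` of classes, if `φ₀ c = a₀ c ≥ 0`,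
`φ c = w c · φ₀ c` with `w c > 0`, and `Σᶠ_{c ∈ S} φ₀ c ≠ 0`, then `Σᶠ_{c ∈ S} φ c = ρ · Σᶠ_{c ∈ S} φ₀ c` for some `ρ > 0` (the two sums have the same
finite support; `ρ = (Σ w a₀) ∕ (Σ a₀)`). [cite: Rogawski1990, §4.1 (4.1.1) p. 39; §1.7 p. 6] -/
theorem exists_pos_finsum_mem_eq_mul {ι : Type*} (S : Set ι) (φ φ₀ : ι → ℂ) (a₀ w : ι → ℝ)
    (h₀ : ∀ c ∈ S, φ₀ c = (a₀ c : ℂ)) (ha : ∀ c ∈ S, 0 ≤ a₀ c) (hw : ∀ c ∈ S, 0 < w c)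
    (h : ∀ c ∈ S, φ c = (w c : ℂ) * φ₀ c) (hne : ∑ᶠ c ∈ S, φ₀ c ≠ 0) :
    ∃ ρ : ℝ, 0 < ρ ∧ ∑ᶠ c ∈ S, φ c = (ρ : ℂ) * ∑ᶠ c ∈ S, φ₀ c := by
  classical
  have hfin : (S ∩ Function.support φ₀).Finite := by
    by_contra hinf
    exact hne (finsum_mem_eq_zero_of_infinite hinf)
  set T : Finset ι := hfin.toFinset with hT
  have hTS : ∀ c ∈ T, c ∈ S := fun c hc => ((Set.Finite.mem_toFinset hfin).1 hc).1
  have hsupp : ∀ c ∈ S, (φ c = 0 ↔ φ₀ c = 0) := by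
    intro c hc
    rw [h c hc, mul_eq_zero, Complex.ofReal_eq_zero]
    exact ⟨fun h' => h'.resolve_left (hw c hc).ne', fun h' => Or.inr h'⟩
  have e₀ : S ∩ Function.support φ₀ = ↑T ∩ Function.support φ₀ := by
    rw [hT, Set.Finite.coe_toFinset, Set.inter_assoc, Set.inter_self]
  have e : S ∩ Function.support φ = ↑T ∩ Function.support φ := by
    ext c
    simp only [Set.mem_inter_iff, Function.mem_support, hT, Set.Finite.coe_toFinset]
    constructor
    · rintro ⟨hcS, hc⟩
      exact ⟨⟨hcS, fun h0 => hc ((hsupp c hcS).2 h0)⟩, hc⟩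
    · rintro ⟨⟨hcS, -⟩, hc⟩
      exact ⟨hcS, hc⟩
  rw [finsum_mem_eq_sum_of_inter_support_eq φ₀ e₀] at hne ⊢
  rw [finsum_mem_eq_sum_of_inter_support_eq φ e]
  have hA : ∑ c ∈ T, φ₀ c = ((∑ c ∈ T, a₀ c : ℝ) : ℂ) := by
    rw [Complex.ofReal_sum]; exact Finset.sum_congr rfl fun c hc => h₀ c (hTS c hc)
  have hB : ∑ c ∈ T, φ c = ((∑ c ∈ T, w c * a₀ c : ℝ) : ℂ) := by
    rw [Complex.ofReal_sum]
    exact Finset.sum_congr rfl fun c hc => by rw [h c (hTS c hc), h₀ c (hTS c hc), Complex.ofReal_mul]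
  rw [hA] at hne ⊢
  rw [hB]
  have hA0 : (∑ c ∈ T, a₀ c) ≠ 0 := fun h0 => hne (by rw [h0, Complex.ofReal_zero])
  have hApos : 0 < ∑ c ∈ T, a₀ c := lt_of_le_of_ne (Finset.sum_nonneg fun c hc => ha c (hTS c hc)) (Ne.symm hA0)
  have hBpos : 0 < ∑ c ∈ T, w c * a₀ c := by
    obtain ⟨c, hcT, hc⟩ : ∃ c ∈ T, a₀ c ≠ 0 := Finset.exists_ne_zero_of_sum_ne_zero hA0
    exact Finset.sum_pos' (fun i hi => mul_nonneg (hw i (hTS i hi)).le (ha i (hTS i hi)))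
      ⟨c, hcT, mul_pos (hw c (hTS c hcT)) (lt_of_le_of_ne (ha c (hTS c hcT)) (Ne.symm hc))⟩
  refine ⟨(∑ c ∈ T, w c * a₀ c) / ∑ c ∈ T, a₀ c, div_pos hBpos hApos, ?_⟩
  have hA0' : ((∑ c ∈ T, a₀ c : ℝ) : ℂ) ≠ 0 := by exact_mod_cast hA0
  rw [Complex.ofReal_div, div_mul_cancel₀ _ hA0']

end Nonneg

section NonnegRatio

variable {G : Type*} [Group G] [TopologicalSpace G] [IsTopologicalGroup G] [LocallyCompactSpace G]
  [SecondCountableTopology G] [T2Space G] [MeasurableSpace G] [BorelSpace G]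
  [∀ γ : G, MeasurableSpace (G ⧸ Subgroup.centralizer ({γ} : Set G))]
  [∀ γ : G, BorelSpace (G ⧸ Subgroup.centralizer ({γ} : Set G))]

/-- **POSITIVE TRANSPORT ON A NONNEGATIVE TEST FUNCTION** — no single-class support needed.  Let `m = dν ∕ dt`, `m₀ = dν ∕ dt₀` on the `P`-classes
(★ `IsQuotientOf`, SAME Haar `ν`), every class of `𝒪_st(γ)` guarded by `P`, and `f` a REAL NONNEGATIVE test function with `Φ^st_{m₀}(γ, f) ≠ 0`.  Then
`Φ^st_m(γ, f) = ρ · Φ^st_{m₀}(γ, f)` with `ρ > 0`: class by class `m c = κ_c⁻¹ • m₀ c` (★ `IsQuotientOf.exists_eq_smul`, the ratios `κ_c > 0` may DIFFER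
between the sheets of the stable class), every class orbital integral of `f` is `≥ 0`, so the two class sums are positive combinations of the same
nonnegative numbers.  This is what lets (κ-loc) for an ARBITRARY coherent singular system inherit the PHASE of the |ω|-constant from ONE nonnegative smooth
`f` charging `γ_{0,v}` (socket #6 `sig_K2E3StableDistributionSingular` with a nonnegative witness) and its transfer `f^H` (★ `IsLocalDeltaTransferExists` in `hCTM`).
[cite: Rogawski1990, §1.7 p. 6; §4.1 (4.1.1) p. 39; §4.3 (4.3.1) p. 43] [cite: DeitmarEchterhoff2014, Thm. 1.5.3] -/
theorem exists_pos_stableOrbitalIntegralRel_eq_mul_of_nonneg (st : G → G → Prop) {P : G → Prop} {ν : Measure G} [ν.IsHaarMeasure]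
    [ν.IsMulRightInvariant] {t t₀ : ∀ γ : G, Measure (Subgroup.centralizer ({γ} : Set G))} {m m₀ : OrbitalMeasureFamily G}
    (h : m.IsQuotientOf P ν t) (h₀ : m₀.IsQuotientOf P ν t₀) {γ : G} (hP : ∀ c : ConjClasses G, st γ (Quotient.out c) → P (Quotient.out c))
    (f : G → ℂ) (hf : ∀ x, 0 ≤ (f x).re ∧ (f x).im = 0) (hne : stableOrbitalIntegralRel st m₀ f γ ≠ 0) :
    ∃ ρ : ℝ, 0 < ρ ∧ stableOrbitalIntegralRel st m f γ = (ρ : ℂ) * stableOrbitalIntegralRel st m₀ f γ := by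
  classical
  -- `f` is the coercion of the nonnegative real function `g = re ∘ f`
  set g : G → ℝ := fun x => (f x).re with hg
  have hfg : f = fun x => (g x : ℂ) := by
    funext x
    exact Complex.ext (by simp [hg]) (by simp [hg, (hf x).2])
  have hg0 : ∀ x, 0 ≤ g x := fun x => (hf x).1
  -- class-by-class weights from the two Weil forms
  have hw : ∀ c : ConjClasses G, st γ (Quotient.out c) →
      ∃ κ : ℝ≥0, 0 < κ ∧ classOrbitalIntegral m f c = (((κ⁻¹ : ℝ≥0) : ℝ) : ℂ) * classOrbitalIntegral m₀ f c := by
    intro c hc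
    obtain ⟨κ, hκ, -, hm⟩ := h.exists_eq_smul h₀ c (hP c hc)
    refine ⟨κ, hκ, ?_⟩
    rw [classOrbitalIntegral_eq, classOrbitalIntegral_eq, hm, orbitalIntegral_smul_measure, Complex.real_smul, ENNReal.coe_toReal]
  choose! κ hκpos hκeq using hw
  rw [stableOrbitalIntegralRel_def] at hne ⊢
  rw [stableOrbitalIntegralRel_def]
  refine exists_pos_finsum_mem_eq_mul {c : ConjClasses G | st γ (Quotient.out c)} (classOrbitalIntegral m f) (classOrbitalIntegral m₀ f)
    (fun c => orbitalIntegral (Quotient.out c) g (m₀ c)) (fun c => ((κ c)⁻¹ : ℝ≥0)) ?_ ?_ ?_ ?_ hne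
  · intro c _
    rw [classOrbitalIntegral_eq, hfg, orbitalIntegral_ofReal]
  · intro c _
    exact orbitalIntegral_nonneg _ hg0 _
  · intro c hc
    exact_mod_cast inv_pos.2 (hκpos c hc)
  · intro c hc
    exact hκeq c hc

end NonnegRatio

/-! ## §5 The CM dress: a finite place `v`, the `cmDatum` carrier of `G′_v = U(H′)(L⁺_v)`, two singular systems of the same `νG_v` -/

section CM

variable (L : Type) [Field L] [NumberField L] [IsCMField L] (H' : Matrix (Fin 3) (Fin 3) L)
  (v : HeightOneSpectrum (𝓞 ↥(maximalRealSubfield L)))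
  [∀ γ : (UnitaryGroup.cmDatum L 3 H').Local v,
    MeasurableSpace ((UnitaryGroup.cmDatum L 3 H').Local v ⧸ Subgroup.centralizer ({γ} : Set ((UnitaryGroup.cmDatum L 3 H').Local v)))]
  [∀ γ : (UnitaryGroup.cmDatum L 3 H').Local v,
    BorelSpace ((UnitaryGroup.cmDatum L 3 H').Local v ⧸ Subgroup.centralizer ({γ} : Set ((UnitaryGroup.cmDatum L 3 H').Local v)))]
  [MeasurableSpace ((UnitaryGroup.cmDatum L 3 H').Local v)] [BorelSpace ((UnitaryGroup.cmDatum L 3 H').Local v)]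

/-- **ONE-CLASS HAAR-RATIO TRANSPORT FOR `Φ^st` ON `G′_v = U(H′)(L⁺_v)`** (★ `localStableOrbitalIntegral`, stable conjugacy = ★ `IsStablyConj` = `GL₃(L ⊗ L⁺_v)`-conjugacy):
two families `mGs₀ = dνG_v ∕ dt`, `m₀ = dνG_v ∕ dt₀` on the same guard `P` (e.g. the singular guard of (Q-fin)₀ and the |ω|_v-partners ★ `finTamagawaPartner`),
a guarded class `c₀`, and a test function `f` vanishing on the other classes of the stable class of `γ`: `Φ^st_{mGs₀}(γ, f) = κ⁻¹ · Φ^st_{m₀}(γ, f)` with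
`κ > 0` the Haar ratio `t (out c₀) = κ • t₀ (out c₀)`. [cite: Rogawski1990, §1.7 p. 6; §4.1 (4.1.1) p. 39; §4.3 (4.3.1) p. 43] [cite: DeitmarEchterhoff2014, Thm. 1.5.3] -/
theorem exists_pos_localStableOrbitalIntegral_eq_mul {P : (UnitaryGroup.cmDatum L 3 H').Local v → Prop}
    (νG : Measure ((UnitaryGroup.cmDatum L 3 H').Local v)) [νG.IsHaarMeasure] [νG.IsMulRightInvariant]
    {t t₀ : ∀ γ : (UnitaryGroup.cmDatum L 3 H').Local v, Measure (Subgroup.centralizer ({γ} : Set ((UnitaryGroup.cmDatum L 3 H').Local v)))}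
    {mGs₀ m₀ : OrbitalMeasureFamily ((UnitaryGroup.cmDatum L 3 H').Local v)}
    (h : (mGs₀).IsQuotientOf P νG t) (h₀ : (m₀).IsQuotientOf P νG t₀) {γ : (UnitaryGroup.cmDatum L 3 H').Local v}
    (c₀ : ConjClasses ((UnitaryGroup.cmDatum L 3 H').Local v)) (hc₀ : P (Quotient.out c₀)) (f : (UnitaryGroup.cmDatum L 3 H').Local v → ℂ)
    (hf : ∀ c : ConjClasses ((UnitaryGroup.cmDatum L 3 H').Local v),
      IsStablyConj (UnitaryGroup.conjLocal L (IsCMField.complexConj L) v) ((UnitaryGroup.adelicForm L 3 H').map (UnitaryGroup.adeleToLocal L v)) γ (Quotient.out c) →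
      c ≠ c₀ → ∀ g : (UnitaryGroup.cmDatum L 3 H').Local v, f (g * Quotient.out c * g⁻¹) = 0) :
    ∃ κ : ℝ≥0, 0 < κ ∧ t (Quotient.out c₀) = κ • t₀ (Quotient.out c₀) ∧
      localStableOrbitalIntegral L 3 H' v mGs₀ f γ = ((κ⁻¹ : ℝ≥0) : ℂ) * localStableOrbitalIntegral L 3 H' v m₀ f γ :=
  exists_pos_stableOrbitalIntegralRel_eq_mul_of_isQuotientOf _ h h₀ c₀ hc₀ f hf

/-- **POSITIVE TRANSPORT ON A NONNEGATIVE TEST FUNCTION, ON `G′_v = U(H′)(L⁺_v)`** (★ `localStableOrbitalIntegral`): two singular systems `mGs₀ = dνG_v ∕ dt`,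
`m₀ = dνG_v ∕ dt₀` on a guard `P` holding on the whole stable class of `γ`, a REAL NONNEGATIVE `f` with `Φ^st_{m₀}(γ, f) ≠ 0` ⇒
`Φ^st_{mGs₀}(γ, f) = ρ · Φ^st_{m₀}(γ, f)`, `ρ > 0` — the (κ-loc) constant of `mGs₀` at `γ` is `ρ` times that of `m₀` on such an `f` (same phase).
[cite: Rogawski1990, §1.7 p. 6; §4.1 (4.1.1) p. 39; §8.2 Prop. 8.2.1 (a) p. 118] [cite: DeitmarEchterhoff2014, Thm. 1.5.3] -/
theorem exists_pos_localStableOrbitalIntegral_eq_mul_of_nonneg {P : (UnitaryGroup.cmDatum L 3 H').Local v → Prop}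
    (νG : Measure ((UnitaryGroup.cmDatum L 3 H').Local v)) [νG.IsHaarMeasure] [νG.IsMulRightInvariant]
    {t t₀ : ∀ γ : (UnitaryGroup.cmDatum L 3 H').Local v, Measure (Subgroup.centralizer ({γ} : Set ((UnitaryGroup.cmDatum L 3 H').Local v)))}
    {mGs₀ m₀ : OrbitalMeasureFamily ((UnitaryGroup.cmDatum L 3 H').Local v)}
    (h : (mGs₀).IsQuotientOf P νG t) (h₀ : (m₀).IsQuotientOf P νG t₀) {γ : (UnitaryGroup.cmDatum L 3 H').Local v}
    (hP : ∀ c : ConjClasses ((UnitaryGroup.cmDatum L 3 H').Local v),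
      IsStablyConj (UnitaryGroup.conjLocal L (IsCMField.complexConj L) v) ((UnitaryGroup.adelicForm L 3 H').map (UnitaryGroup.adeleToLocal L v)) γ (Quotient.out c) →
      P (Quotient.out c))
    (f : (UnitaryGroup.cmDatum L 3 H').Local v → ℂ) (hf : ∀ x, 0 ≤ (f x).re ∧ (f x).im = 0)
    (hne : localStableOrbitalIntegral L 3 H' v m₀ f γ ≠ 0) :
    ∃ ρ : ℝ, 0 < ρ ∧ localStableOrbitalIntegral L 3 H' v mGs₀ f γ = (ρ : ℂ) * localStableOrbitalIntegral L 3 H' v m₀ f γ :=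
  exists_pos_stableOrbitalIntegralRel_eq_mul_of_nonneg _ h h₀ hP f hf hne

end CM

end Summit.HodgeConjecture.HodgeConjecture.Cruxes.H413.K2E4OneClassHaarRatioTransport

end
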